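import Literature.Probability.RandomPlanarGeometry.SLERestrictionBoundaryKappa
import Literature.Probability.RandomPlanarGeometry.SLERestrictionLocalMartingale
import HarnessLib

/-!
# The localised compensated restriction martingale of [LSW] Prop. 5.3 (`0 < κ ≤ 8/3`) is a martingale

General-`κ` twin of `SLERestrictionLocalMartingale` (the case `κ = 8/3`, `α = 5/8`, `λ = 0`), after
G. F. Lawler, O. Schramm, W. Werner, *Conformal restriction: the chordal case* (2003) (**[LSW]**),
§5 Prop. 5.3: for `α = (6 − κ)/(2κ)`, `λ = (8 − 3κ)(6 − κ)/(2κ)` and `κ ≤ 8/3`,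
"`Y_t = h_t′(W_t)^α exp(λ ∫₀ᵗ Sh_s(W_s)/6 ds)`, `t < T`, is a bounded martingale".

For a nonempty `*`-hull `A` and `n ∈ ℕ`, the stopped process

  `Mⁿ_t = Ỹ_{t ∧ Tₙ}`,   `Ỹ_t = (D̂ⁿ⁺¹_t)^α e^{−λ Iⁿ_t}`,   `Iⁿ_t = ∫₀ᵗ 𝟙{s ≤ Tₙ} m(A_s − W_s) ds`

(`= Φ′_{A_t − W_t}(0)^α exp(−λ ∫₀ᵗ m(A_s − W_s) ds)` up to `Tₙ`; `DhatpK`, `locTimeK` of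
`SLERestrictionProcessesKappa`, `IpnK` of `SLERestrictionCompensatorKappa`) is a bounded `𝓕`-martingale
of the driving Brownian motion (`martingale_locMartK`). In print this is Itô's formula for the random
conformal maps `h_t`; here, as at `κ = 8/3`, **conditional increments**: over a partition of `[s, t]` of
mesh `h`, the increment of `Mⁿ` over a cell `[u, u + h]` splits into the conditional one-step term with
the `𝓕_u`-measurable weight `𝟙_S 𝟙{u < Tₙ} e^{−λ Iⁿ_u}`, of expectation `O(h^{3/2})`
(`abs_integral_mul_sub_leK`), and a boundary term supported on `{u < Tₙ < u + h}`, small by the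
boundary-cell estimate `abs_stoppedK_sub_le` off an event of small driver oscillation whose
probability is `O(h²)`; letting the mesh and then the oscillation threshold go to `0` gives
`E[𝟙_S (Mⁿ_t − Mⁿ_s)] = 0` for `S ∈ 𝓕_s`.

## References

* [LSW] Prop. 5.3 (§5). [LawlerSchrammWerner2003Restriction]
-/

noncomputable section

open Set Filter Metric Function MeasureTheory ProbabilityTheory
open _root_.Complex _root_.Topology
open Literature.Probability.Process (brownian preWienerMeasure runSup)
open scoped NNReal

namespace Literature.Probability.RandomPlanarGeometry

open Loewner PathOps

section LocMart

variable {κ : ℝ≥0} {α lam : ℝ} (hκ0 : 0 < κ) (hκ : κ ≤ 8 / 3) (hαdef : α = (6 - κ) / (2 * κ))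
  (hlamdef : lam = (8 - 3 * κ) * (6 - κ) / (2 * κ))
  {A : Set ℂ} (hA : IsStarHull A) (hne : A.Nonempty) (n : ℕ)

variable (κ α lam) in
/-- `Ỹ_t = (D̂ⁿ⁺¹_t)^α e^{−λ Iⁿ_t}`. [folklore] -/
def YtilK (t : ℝ≥0) (ω : ℝ≥0 → ℝ) : ℝ :=
  DhatpK κ hA hne (n + 1) t ω ^ α * Real.exp (-(lam * IpnK κ hA hne n t ω))

variable (κ α lam) in
/-- **The localised compensated restriction martingale** `Mⁿ_t = Ỹ_{t ∧ Tₙ}`.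
[cite: LawlerSchrammWerner2003Restriction, Prop. 5.3] -/
def locMartK : ℝ≥0 → (ℝ≥0 → ℝ) → ℝ := stoppedProcess (YtilK κ α lam hA hne n) (locTimeK κ hA hne n)

variable {hA hne n}

/-- `0 ≤ Ỹ ≤ 1` (for `α > 0`, `λ ≥ 0`). [folklore] -/
theorem YtilK_mem_Icc (hα : 0 < α) (hlam : 0 ≤ lam) (t : ℝ≥0) (ω : ℝ≥0 → ℝ) :
    YtilK κ α lam hA hne n t ω ∈ Icc (0 : ℝ) 1 := by
  obtain ⟨h0, h1⟩ := DhatFnK_mem_Icc (κ := κ) (hA := hA) (hne := hne) (n + 1) t (brownianCPath ω)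
  have e0 : 0 ≤ DhatpK κ hA hne (n + 1) t ω ^ α := Real.rpow_nonneg h0 _
  have e1 : DhatpK κ hA hne (n + 1) t ω ^ α ≤ 1 := Real.rpow_le_one h0 h1 hα.le
  have c0 : 0 < Real.exp (-(lam * IpnK κ hA hne n t ω)) := Real.exp_pos _
  have c1 : Real.exp (-(lam * IpnK κ hA hne n t ω)) ≤ 1 := by
    rw [Real.exp_le_one_iff, neg_nonpos]; exact mul_nonneg hlam (IpnK_nonneg n t ω)
  exact ⟨mul_nonneg e0 c0.le, mul_le_one₀ e1 c0.le c1⟩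

/-- `0 ≤ Mⁿ ≤ 1`. [folklore] -/
theorem locMartK_mem_Icc (hα : 0 < α) (hlam : 0 ≤ lam) (t : ℝ≥0) (ω : ℝ≥0 → ℝ) :
    locMartK κ α lam hA hne n t ω ∈ Icc (0 : ℝ) 1 :=
  YtilK_mem_Icc hα hlam _ _

/-- `Ỹ` has continuous paths (for `α > 0`). [folklore] -/
theorem continuous_YtilK (hα : 0 < α) (ω : ℝ≥0 → ℝ) : Continuous fun t ↦ YtilK κ α lam hA hne n t ω :=
  ((continuous_RpK_DhatpK (κ := κ) (hA := hA) (hne := hne) (n + 1) ω).2.rpow_const fun _ ↦ Or.inr hα.le).mul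
    (continuous_const.mul (continuous_IpnK n ω)).neg.rexp

/-- `Ỹ` is adapted. [folklore] -/
theorem adapted_YtilK : Adapted brownianFiltration (YtilK κ α lam hA hne n) := fun t ↦
  ((adapted_DhatpK (κ := κ) (hA := hA) (hne := hne) (n + 1) t).pow_const _).mul
    ((adapted_IpnK (κ := κ) (hA := hA) (hne := hne) n t).const_mul lam).neg.exp

/-- **`Mⁿ` is strongly adapted** (stopped continuous adapted process). [folklore] -/
theorem stronglyAdapted_locMartK (hα : 0 < α) : StronglyAdapted brownianFiltration (locMartK κ α lam hA hne n) :=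
  (adapted_YtilK.stronglyAdapted).stoppedProcess (continuous_YtilK hα) (isStoppingTime_locTimeK n)

/-- `Mⁿ_t` is integrable. [folklore] -/
theorem integrable_locMartK (hα : 0 < α) (hlam : 0 ≤ lam) (t : ℝ≥0) :
    Integrable (locMartK κ α lam hA hne n t) preWienerMeasure := by
  haveI := isProbabilityMeasure_preWienerMeasure'
  refine (integrable_const (1 : ℝ)).mono' (((stronglyAdapted_locMartK hα) t).mono (brownianFiltration.le t)).aestronglyMeasurable
    (Eventually.of_forall fun ω ↦ ?_)
  rw [Real.norm_eq_abs, abs_of_nonneg (locMartK_mem_Icc hα hlam t ω).1]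
  exact (locMartK_mem_Icc hα hlam t ω).2

/-! ### The cell decomposition -/

/-- On `{u < Tₙ}`, `Mⁿ_u = Φ′_{A_u − W_u}(0)^α e^{−λ Iⁿ_u}`. [folklore] -/
theorem locMartK_eq_of_lt {u : ℝ≥0} {ω : ℝ≥0 → ℝ} (hT : (u : WithTop ℝ≥0) < locTimeK κ hA hne n ω) :
    locMartK κ α lam hA hne n u ω =
      starDeriv (slidHull (drvK κ (brownianCPath ω)) A u) ^ α * Real.exp (-(lam * IpnK κ hA hne n u ω)) := by
  rw [locMartK, stoppedProcess, min_eq_left hT.le, Process.untopA_coe, YtilK]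
  obtain ⟨-, -, hDeq, -, -⟩ := controlled_of_lt_locTimeK hT
  rw [hDeq]

/-- **The cell decomposition**: with `g = 𝟙_S 𝟙{u < Tₙ} e^{−λ Iⁿ_u}` and
`Ŷ′_{u+h} = D_{u+h}^α 𝟙{alive} e^{−λ ∫ᵤ^{u+h} m}`, `Y_u = Φ′_{A_u − W_u}(0)^α`,
`𝟙_S (Mⁿ_{u+h} − Mⁿ_u) = g · (Ŷ′_{u+h} − Y_u) + 𝟙_S 𝟙{u < Tₙ} · (Mⁿ_{u+h} − e^{−λ Iⁿ_u} Ŷ′_{u+h})`. [folklore] -/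
theorem indicator_mul_locMartK_sub (S : Set (ℝ≥0 → ℝ)) (u h : ℝ≥0) (ω : ℝ≥0 → ℝ) :
    S.indicator (fun _ ↦ (1 : ℝ)) ω * (locMartK κ α lam hA hne n (u + h) ω - locMartK κ α lam hA hne n u ω) =
      (S.indicator (fun _ ↦ (1 : ℝ)) ω * {ω | (u : WithTop ℝ≥0) < locTimeK κ hA hne n ω}.indicator (fun _ ↦ (1 : ℝ)) ω *
          Real.exp (-(lam * IpnK κ hA hne n u ω))) *
          (DFnK κ A (u + h) (brownianCPath ω) ^ α * Real.exp (-(lam * JFnK κ A u h (brownianCPath ω))) -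
            starDeriv (slidHull (drvK κ (brownianCPath ω)) A u) ^ α) +
        (S.indicator (fun _ ↦ (1 : ℝ)) ω * {ω | (u : WithTop ℝ≥0) < locTimeK κ hA hne n ω}.indicator (fun _ ↦ (1 : ℝ)) ω) *
          (locMartK κ α lam hA hne n (u + h) ω - Real.exp (-(lam * IpnK κ hA hne n u ω)) *
            (DFnK κ A (u + h) (brownianCPath ω) ^ α * Real.exp (-(lam * JFnK κ A u h (brownianCPath ω))))) := by
  by_cases hT : (u : WithTop ℝ≥0) < locTimeK κ hA hne n ω
  · rw [Set.indicator_of_mem (show ω ∈ {ω | (u : WithTop ℝ≥0) < locTimeK κ hA hne n ω} from hT), mul_one,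
      locMartK_eq_of_lt hT]
    ring
  · rw [Set.indicator_of_notMem (show ω ∉ {ω | (u : WithTop ℝ≥0) < locTimeK κ hA hne n ω} from hT), mul_zero, zero_mul,
      zero_mul, zero_mul, add_zero]
    have : locMartK κ α lam hA hne n (u + h) ω = locMartK κ α lam hA hne n u ω := by
      rw [not_lt] at hT
      have hT' : locTimeK κ hA hne n ω ≤ ((u + h : ℝ≥0) : WithTop ℝ≥0) := hT.trans (by exact_mod_cast le_self_add)
      rw [locMartK, stoppedProcess, stoppedProcess, min_eq_right hT, min_eq_right hT']
    rw [this, sub_self, mul_zero]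

/-! ### The integral over one cell -/

section Cell

variable [MeasurableSpace C(ℝ≥0, ℝ)] [BorelSpace C(ℝ≥0, ℝ)]

include hA hne in
/-- Measurability of the pieces. [folklore] -/
theorem measurable_piecesK (hα : 0 < α) (u h : ℝ≥0) :
    Measurable (locMartK κ α lam hA hne n (u + h)) ∧ Measurable (locMartK κ α lam hA hne n u) ∧
      Measurable (fun ω ↦ DFnK κ A (u + h) (brownianCPath ω) ^ α * Real.exp (-(lam * JFnK κ A u h (brownianCPath ω)))) ∧
      MeasurableSet {ω | (u : WithTop ℝ≥0) < locTimeK κ hA hne n ω} ∧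
      MeasurableSet {ω | locTimeK κ hA hne n ω < ((u + h : ℝ≥0) : WithTop ℝ≥0)} ∧
      Measurable[brownianFiltration u] (fun ω ↦ Real.exp (-(lam * IpnK κ hA hne n u ω))) := by
  refine ⟨((stronglyAdapted_locMartK hα) (u + h)).measurable.mono (brownianFiltration.le _) le_rfl,
    ((stronglyAdapted_locMartK hα) u).measurable.mono (brownianFiltration.le _) le_rfl,
    (((measurable_DFnK hA hne (u + h)).comp measurable_brownianCPath).pow_const _).mul
      (((measurable_JFnK hA hne u h).comp measurable_brownianCPath).const_mul lam).neg.exp,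
    brownianFiltration.le u _ ((isStoppingTime_locTimeK n).measurableSet_gt u),
    brownianFiltration.le (u + h) _ ((isStoppingTime_locTimeK n).measurableSet_lt (u + h)),
    ((adapted_IpnK (κ := κ) (hA := hA) (hne := hne) n u).const_mul lam).neg.exp⟩

include hκ0 hκ hαdef hlamdef in
/-- **The cell estimate in expectation.** For `s ≤ u`, `S ∈ 𝓕_s`, a threshold `κ₀ > 0` and a small
step `h`: `|∫_S (Mⁿ_{u+h} − Mⁿ_u)| ≤ stepCK α λ (cₙ/2) (cₙ/16) h√h +
(powErr α (2Δ₀) + λ h massBdCell n) P(u < Tₙ < u+h) + 128 σ⁴ h²/κ₀⁴`.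
[cite: LawlerSchrammWerner2003Restriction, Prop. 5.3] -/
theorem abs_setIntegral_cell_leK {s u h : ℝ≥0} (hsu : s ≤ u) {S : Set (ℝ≥0 → ℝ)} (hS : MeasurableSet[brownianFiltration s] S)
    {κ₀ : ℝ} (hκ₀ : 0 < κ₀) (hh0 : 0 < h)
    (hh1 : (h : ℝ) ≤ (locLevel n / 2 * (locLevel n / 16) / 4000) ^ 2 / 32)
    (hh2 : stepSize κ₀ h ≤ locLevel n * (locLevel n / 16) / 1000)
    (hh4 : (h : ℝ) ≤ (κ₀ / stepSigma / 2) ^ 2 / 2)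
    (hh5 : lam * (h * massBdCell n) ≤ 1) :
    |∫ ω in S, (locMartK κ α lam hA hne n (u + h) ω - locMartK κ α lam hA hne n u ω) ∂preWienerMeasure| ≤
      stepCK α lam (locLevel n / 2) (locLevel n / 16) * h * Real.sqrt h +
        (powErr α (2 * cellErr n κ₀ h) + lam * (h * massBdCell n)) *
          preWienerMeasure.real {ω | (u : WithTop ℝ≥0) < locTimeK κ hA hne n ω ∧
            locTimeK κ hA hne n ω < ((u + h : ℝ≥0) : WithTop ℝ≥0)} +
        128 * (h : ℝ) ^ 2 / (κ₀ / stepSigma) ^ 4 := by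
  haveI := isProbabilityMeasure_preWienerMeasure'
  obtain ⟨hαpos, hlam0⟩ := exponents_pos hκ hαdef hlamdef hκ0
  obtain ⟨hc0, hc1⟩ := locLevel_pos_le n
  have hσ := stepSigma_pos
  obtain ⟨hMm1, hMm0, hYhm, hEgt, hElt, hCum⟩ := measurable_piecesK (κ := κ) (lam := lam) (hA := hA) (hne := hne) (n := n) hαpos u h
  have hSm : MeasurableSet S := brownianFiltration.le s _ hS
  set T := locTimeK κ hA hne n with hT
  set Cu : (ℝ≥0 → ℝ) → ℝ := fun ω ↦ Real.exp (-(lam * IpnK κ hA hne n u ω)) with hCu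
  set g0 : (ℝ≥0 → ℝ) → ℝ := fun ω ↦ S.indicator (fun _ ↦ (1 : ℝ)) ω * {ω | (u : WithTop ℝ≥0) < T ω}.indicator (fun _ ↦ (1 : ℝ)) ω
    with hg0
  set g : (ℝ≥0 → ℝ) → ℝ := fun ω ↦ g0 ω * Cu ω with hg
  set Yh : (ℝ≥0 → ℝ) → ℝ := fun ω ↦ DFnK κ A (u + h) (brownianCPath ω) ^ α *
    Real.exp (-(lam * JFnK κ A u h (brownianCPath ω))) with hYh
  set Yu : (ℝ≥0 → ℝ) → ℝ := fun ω ↦ starDeriv (slidHull (drvK κ (brownianCPath ω)) A u) ^ α with hYu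
  set b : (ℝ≥0 → ℝ) → ℝ := fun ω ↦ g0 ω * (locMartK κ α lam hA hne n (u + h) ω - Cu ω * Yh ω) with hb
  -- `Cu ∈ (0, 1]`
  have hCu01 : ∀ ω, 0 < Cu ω ∧ Cu ω ≤ 1 := fun ω ↦
    ⟨Real.exp_pos _, by rw [hCu]; simp only; rw [Real.exp_le_one_iff, neg_nonpos]; exact mul_nonneg hlam0 (IpnK_nonneg n u ω)⟩
  -- `g0` is `𝓕_u`-measurable with values in `{0, 1}`, `g = g0 · Cu ∈ [0, 1]`
  have hg0mu : Measurable[brownianFiltration u] g0 := by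
    have h1 : Measurable[brownianFiltration u] (S.indicator fun _ ↦ (1 : ℝ)) :=
      (measurable_const (a := (1 : ℝ))).indicator (brownianFiltration.mono hsu _ hS)
    have h2 : Measurable[brownianFiltration u] ({ω | (u : WithTop ℝ≥0) < T ω}.indicator fun _ ↦ (1 : ℝ)) :=
      (measurable_const (a := (1 : ℝ))).indicator ((isStoppingTime_locTimeK n).measurableSet_gt u)
    exact h1.mul h2
  have hgmu : Measurable[brownianFiltration u] g := hg0mu.mul hCum
  have hg0m : Measurable g0 := hg0mu.mono (brownianFiltration.le u) le_rfl
  have hgm : Measurable g := hgmu.mono (brownianFiltration.le u) le_rfl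
  have hg0_01 : ∀ ω, g0 ω = 0 ∨ g0 ω = 1 := fun ω ↦ by
    rw [hg0]; simp only
    by_cases h1 : ω ∈ S
    · by_cases h2 : ω ∈ {ω | (u : WithTop ℝ≥0) < T ω}
      · rw [Set.indicator_of_mem h1, Set.indicator_of_mem h2]; norm_num
      · rw [Set.indicator_of_mem h1, Set.indicator_of_notMem h2]; norm_num
    · rw [Set.indicator_of_notMem h1, zero_mul]; exact Or.inl rfl
  have hg0abs : ∀ ω, |g0 ω| ≤ 1 := fun ω ↦ by rcases hg0_01 ω with h | h <;> rw [h] <;> norm_num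
  have hg01 : ∀ ω, g ω ∈ Icc (0 : ℝ) 1 := fun ω ↦ by
    rw [hg]; simp only
    rcases hg0_01 ω with h | h
    · rw [h, zero_mul]; exact ⟨le_rfl, zero_le_one⟩
    · rw [h, one_mul]; exact ⟨(hCu01 ω).1.le, (hCu01 ω).2⟩
  have hg0T : ∀ ω, g0 ω ≠ 0 → (u : WithTop ℝ≥0) < T ω := fun ω hω ↦ by
    by_contra hnot
    exact hω (by rw [hg0]; simp only; rw [Set.indicator_of_notMem (show ω ∉ {ω | (u : WithTop ℝ≥0) < T ω} from hnot), mul_zero])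
  have hgT : ∀ ω, g ω ≠ 0 → (u : WithTop ℝ≥0) < T ω := fun ω hω ↦ by
    refine hg0T ω fun h0 ↦ hω ?_
    rw [hg]; simp only; rw [h0, zero_mul]
  -- rewrite the set integral through the cell decomposition
  have hdec : ∀ ω, S.indicator (fun ω ↦ locMartK κ α lam hA hne n (u + h) ω - locMartK κ α lam hA hne n u ω) ω =
      g ω * (Yh ω - Yu ω) + b ω := fun ω ↦ by
    have := indicator_mul_locMartK_sub (κ := κ) (α := α) (lam := lam) (hA := hA) (hne := hne) (n := n) S u h ω
    rw [← hT] at this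
    have e : S.indicator (fun ω ↦ locMartK κ α lam hA hne n (u + h) ω - locMartK κ α lam hA hne n u ω) ω =
        S.indicator (fun _ ↦ (1 : ℝ)) ω * (locMartK κ α lam hA hne n (u + h) ω - locMartK κ α lam hA hne n u ω) := by
      by_cases hω : ω ∈ S <;> simp [hω]
    rw [e, this]
  -- integrability (everything is bounded and measurable)
  have hbdd : ∀ {f : (ℝ≥0 → ℝ) → ℝ}, Measurable f → (∀ ω, |f ω| ≤ 2) → Integrable f preWienerMeasure := fun hf hb ↦
    (integrable_const (2 : ℝ)).mono' hf.aestronglyMeasurable (Eventually.of_forall fun ω ↦ by rw [Real.norm_eq_abs]; exact hb ω)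
  have hg1 : ∀ ω, |g ω| ≤ 1 := fun ω ↦ by rw [abs_of_nonneg (hg01 ω).1]; exact (hg01 ω).2
  have hYh01 : ∀ ω, Yh ω ∈ Icc (0 : ℝ) 1 := fun ω ↦ by
    obtain ⟨-, -, h0, h1⟩ := DFnK_eq (κ := κ) (A := A) (u + h) (brownianCPath ω)
    have e0 : 0 ≤ DFnK κ A (u + h) (brownianCPath ω) ^ α := Real.rpow_nonneg h0 _
    have e1 : DFnK κ A (u + h) (brownianCPath ω) ^ α ≤ 1 := Real.rpow_le_one h0 h1 hαpos.le
    have c0 : 0 < Real.exp (-(lam * JFnK κ A u h (brownianCPath ω))) := Real.exp_pos _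
    have c1 : Real.exp (-(lam * JFnK κ A u h (brownianCPath ω))) ≤ 1 := by
      rw [Real.exp_le_one_iff, neg_nonpos]; exact mul_nonneg hlam0 (JFnK_nonneg hA u h _)
    exact ⟨mul_nonneg e0 c0.le, mul_le_one₀ e1 c0.le c1⟩
  have hYu01 : ∀ ω, Yu ω ∈ Icc (0 : ℝ) 1 := fun ω ↦ by
    obtain ⟨h0, h1⟩ := starDeriv_pos_le_one (slidHull (drvK κ (brownianCPath ω)) A u)
    exact ⟨Real.rpow_nonneg h0.le _, Real.rpow_le_one h0.le h1 hαpos.le⟩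
  have hgYu_m : Measurable fun ω ↦ g ω * Yu ω := by
    have h1 : (fun ω ↦ g ω * Yu ω) = fun ω ↦ g ω * DFnK κ A u (brownianCPath ω) ^ α := by
      funext ω
      by_cases hg0' : g ω = 0
      · rw [hg0', zero_mul, zero_mul]
      · rw [hYu]; simp only
        obtain ⟨halive, -⟩ := controlled_of_lt_locTimeK (hgT ω hg0')
        rw [(DFnK_eq (κ := κ) (A := A) u (brownianCPath ω)).1 halive]
    rw [h1]
    exact hgm.mul (((measurable_DFnK hA hne u).comp measurable_brownianCPath).pow_const _)
  have i1 : Integrable (fun ω ↦ g ω * (Yh ω - Yu ω)) preWienerMeasure := by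
    have : (fun ω ↦ g ω * (Yh ω - Yu ω)) = fun ω ↦ g ω * Yh ω - g ω * Yu ω := by funext ω; ring
    rw [this]
    have iA : Integrable (fun ω ↦ g ω * Yh ω) preWienerMeasure := hbdd (hgm.mul hYhm) fun ω ↦ by
      rw [abs_mul, abs_of_nonneg (hYh01 ω).1]; nlinarith [hg1 ω, (hYh01 ω).1, (hYh01 ω).2, abs_nonneg (g ω)]
    have iB : Integrable (fun ω ↦ g ω * Yu ω) preWienerMeasure := hbdd hgYu_m fun ω ↦ by
      rw [abs_mul, abs_of_nonneg (hYu01 ω).1]; nlinarith [hg1 ω, (hYu01 ω).1, (hYu01 ω).2, abs_nonneg (g ω)]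
    exact iA.sub iB
  have hCum' : Measurable Cu := hCum.mono (brownianFiltration.le u) le_rfl
  have hb_m : Measurable b := hg0m.mul (hMm1.sub (hCum'.mul hYhm))
  have hres : ∀ ω, |locMartK κ α lam hA hne n (u + h) ω - Cu ω * Yh ω| ≤ 1 := fun ω ↦ by
    have hM := locMartK_mem_Icc (κ := κ) (hA := hA) (hne := hne) (n := n) hαpos hlam0 (u + h) ω
    have hp0 : 0 ≤ Cu ω * Yh ω := mul_nonneg (hCu01 ω).1.le (hYh01 ω).1
    have hp1 : Cu ω * Yh ω ≤ 1 := mul_le_one₀ (hCu01 ω).2 (hYh01 ω).1 (hYh01 ω).2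
    rw [abs_le]; constructor <;> linarith [hM.1, hM.2]
  have hb2 : ∀ ω, |b ω| ≤ 2 := fun ω ↦ by
    rw [hb]; simp only; rw [abs_mul]
    nlinarith [hg0abs ω, hres ω, abs_nonneg (g0 ω), abs_nonneg (locMartK κ α lam hA hne n (u + h) ω - Cu ω * Yh ω)]
  have i2 : Integrable b preWienerMeasure := hbdd hb_m hb2
  have hsplit : ∫ ω in S, (locMartK κ α lam hA hne n (u + h) ω - locMartK κ α lam hA hne n u ω) ∂preWienerMeasure =
      ∫ ω, g ω * (Yh ω - Yu ω) ∂preWienerMeasure + ∫ ω, b ω ∂preWienerMeasure := by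
    rw [← integral_indicator hSm, ← integral_add i1 i2]
    exact integral_congr_ae (Eventually.of_forall hdec)
  rw [hsplit]
  -- (I) the conditional one-step term, at `(δ₀, ρ₀) = (cₙ/2, cₙ/16)`
  have hI : |∫ ω, g ω * (Yh ω - Yu ω) ∂preWienerMeasure| ≤ stepCK α lam (locLevel n / 2) (locLevel n / 16) * h * Real.sqrt h := by
    have hlamh : lam * (h * massBound (locLevel n / 2) (locLevel n / 16)) ≤ 1 := hh5
    refine abs_integral_mul_sub_leK hκ0 hκ hαdef hlamdef hA hne (by positivity) (by linarith) (by positivity) hh0 hh1 hlamh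
      hgmu hg01 fun ω hω ↦ ?_
    obtain ⟨halive, -, -, hd, hm⟩ := controlled_of_lt_locTimeK (hgT ω hω)
    refine ⟨halive, ?_, by linarith⟩
    rw [show 16 * (locLevel n / 16) = locLevel n by ring]
    exact disjoint_ball_infDist.mono_left (ball_subset_ball hm.le)
  -- (II) the boundary term
  set E : Set (ℝ≥0 → ℝ) := {ω | (u : WithTop ℝ≥0) < T ω ∧ T ω < ((u + h : ℝ≥0) : WithTop ℝ≥0)} with hE
  set Bad : Set (ℝ≥0 → ℝ) := {ω | κ₀ / stepSigma ≤ oscFn h (incr u (brownianCPath ω))} with hBad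
  have hEm : MeasurableSet E := hEgt.inter hElt
  have hBadm : MeasurableSet Bad :=
    measurableSet_le measurable_const ((measurable_oscFn h).comp ((measurable_incr u).comp measurable_brownianCPath))
  set D : ℝ := powErr α (2 * cellErr n κ₀ h) + lam * (h * massBdCell n) with hD
  have hΔ0 : 0 ≤ cellErr n κ₀ h := by
    rw [cellErr]; have : 0 ≤ stepSize κ₀ h := by rw [stepSize]; positivity
    positivity
  have hD0 : 0 ≤ D := add_nonneg (powErr_nonneg (by positivity)) (mul_nonneg hlam0 (mul_nonneg h.coe_nonneg (massBdCell_nonneg n)))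
  have hpt : ∀ ω, |b ω| ≤ E.indicator (fun _ ↦ D) ω + Bad.indicator (fun _ ↦ (1 : ℝ)) ω := fun ω ↦ by
    have hE0 : 0 ≤ E.indicator (fun _ ↦ D) ω := Set.indicator_nonneg (fun _ _ ↦ hD0) ω
    have hB0 : 0 ≤ Bad.indicator (fun _ ↦ (1 : ℝ)) ω := Set.indicator_nonneg (fun _ _ ↦ zero_le_one) ω
    by_cases hg0' : g0 ω = 0
    · rw [hb]; simp only; rw [hg0', zero_mul, abs_zero]; positivity
    have huT := hg0T ω hg0'
    have hg0le : |g0 ω| ≤ 1 := hg0abs ω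
    rcases le_or_gt (((u + h : ℝ≥0) : WithTop ℝ≥0)) (T ω) with hle | hlt
    · -- no boundary: `Mⁿ_{u+h} = Ỹ_{u+h} = Cu · Yh`
      rw [hb]; simp only
      have hT0 : (0 : WithTop ℝ≥0) < T ω := lt_of_le_of_lt bot_le huT
      have hM : locMartK κ α lam hA hne n (u + h) ω = Cu ω * Yh ω := by
        rw [locMartK, stoppedProcess, min_eq_left hle, Process.untopA_coe, YtilK]
        obtain ⟨halive, -, hDeq, -, -⟩ := controlled_of_le_locTimeK hle hT0
        rw [hDeq, hYh, hCu]; simp only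
        rw [(DFnK_eq (κ := κ) (A := A) (u + h) (brownianCPath ω)).1 halive, IpnK_add_eq_JFnK hle, mul_add, neg_add,
          Real.exp_add]
        ring
      rw [hM, sub_self, mul_zero, abs_zero]; positivity
    · have hωE : ω ∈ E := ⟨huT, hlt⟩
      rw [Set.indicator_of_mem hωE]
      by_cases hbad : ω ∈ Bad
      · rw [Set.indicator_of_mem hbad]
        rw [hb]; simp only; rw [abs_mul]
        nlinarith [abs_nonneg (g0 ω), hres ω, abs_nonneg (locMartK κ α lam hA hne n (u + h) ω - Cu ω * Yh ω)]
      · rw [Set.indicator_of_notMem hbad, add_zero]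
        have hosc : oscFn h (incr u (brownianCPath ω)) < κ₀ / stepSigma := not_le.1 hbad
        have hS' : ∀ r : ℝ≥0, r ≤ h → |drvK κ (brownianCPath ω) (u + r) - drvK κ (brownianCPath ω) u| ≤ κ₀ := fun r hr ↦ by
          have h1 := abs_incr_le_oscFn hr u (brownianCPath ω)
          have : drvK κ (brownianCPath ω) (u + r) - drvK κ (brownianCPath ω) u =
              Real.sqrt κ * ((brownianCPath ω) (u + r) - (brownianCPath ω) u) := by simp only [drvK]; ring
          rw [this, abs_mul, abs_of_nonneg (Real.sqrt_nonneg _)]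
          have hle1 := (lt_div_iff₀' hσ).1 (lt_of_le_of_lt h1 hosc) |>.le
          have hsq := sqrt_le_stepSigma hκ
          calc Real.sqrt κ * |(brownianCPath ω) (u + r) - (brownianCPath ω) u|
              ≤ stepSigma * |(brownianCPath ω) (u + r) - (brownianCPath ω) u| :=
                mul_le_mul_of_nonneg_right hsq (abs_nonneg _)
            _ ≤ κ₀ := hle1
        have key := abs_stoppedK_sub_le (κ := κ) (hA := hA) (hne := hne) (n := n) huT hh0 hS' hh2 hαpos hlam0
        rw [hb]; simp only; rw [abs_mul]
        have key' : |locMartK κ α lam hA hne n (u + h) ω - Cu ω * Yh ω| ≤ D := key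
        calc |g0 ω| * |locMartK κ α lam hA hne n (u + h) ω - Cu ω * Yh ω| ≤ 1 * D := mul_le_mul hg0le key' (abs_nonneg _) zero_le_one
          _ = D := one_mul _
  have hII : |∫ ω, b ω ∂preWienerMeasure| ≤ D * preWienerMeasure.real E + 128 * (h : ℝ) ^ 2 / (κ₀ / stepSigma) ^ 4 := by
    have iE : Integrable (E.indicator fun _ ↦ D) preWienerMeasure := (integrable_const D).indicator hEm
    have iB : Integrable (Bad.indicator fun _ ↦ (1 : ℝ)) preWienerMeasure := (integrable_const (1 : ℝ)).indicator hBadm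
    calc |∫ ω, b ω ∂preWienerMeasure| ≤ ∫ ω, |b ω| ∂preWienerMeasure := abs_integral_le_integral_abs
      _ ≤ ∫ ω, (E.indicator (fun _ ↦ D) ω + Bad.indicator (fun _ ↦ (1 : ℝ)) ω) ∂preWienerMeasure :=
          integral_mono i2.abs (iE.add iB) hpt
      _ = D * preWienerMeasure.real E + preWienerMeasure.real Bad := by
          rw [integral_add iE iB, integral_indicator_const _ hEm, integral_indicator_const _ hBadm]
          simp [smul_eq_mul, mul_comm]
      _ ≤ D * preWienerMeasure.real E + 128 * (h : ℝ) ^ 2 / (κ₀ / stepSigma) ^ 4 := by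
          have := measureReal_oscFn_incr_ge_le h u (by positivity : 0 < κ₀ / stepSigma) hh4
          linarith
  calc |∫ ω, g ω * (Yh ω - Yu ω) ∂preWienerMeasure + ∫ ω, b ω ∂preWienerMeasure|
      ≤ |∫ ω, g ω * (Yh ω - Yu ω) ∂preWienerMeasure| + |∫ ω, b ω ∂preWienerMeasure| := abs_add_le _ _
    _ ≤ _ := by rw [hD] at hII; linarith [hI, hII]

end Cell

/-! ### Telescoping over a partition -/

/-- `powErr α` is continuous on `[0, ∞)` at every `r ≥ 0`, in the form needed. [folklore] -/
theorem tendsto_powErr {α : ℝ} (hα : 0 < α) {ι : Type*} {l : Filter ι} {f : ι → ℝ} {r : ℝ}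
    (hf : Tendsto f l (𝓝 r)) : Tendsto (fun i ↦ powErr α (f i)) l (𝓝 (powErr α r)) := by
  have hc : Continuous fun x : ℝ ↦ powErr α x :=
    continuous_const.mul (Real.continuous_rpow_const (le_min hα.le zero_le_one))
  exact (hc.tendsto r).comp hf

/-- `powErr α 0 = 0` (for `α > 0`). [folklore] -/
theorem powErr_zero {α : ℝ} (hα : 0 < α) : powErr α 0 = 0 := by
  rw [powErr, Real.zero_rpow (lt_min hα one_pos).ne', mul_zero]

section Partition

variable [MeasurableSpace C(ℝ≥0, ℝ)] [BorelSpace C(ℝ≥0, ℝ)]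

include hκ0 hκ hαdef hlamdef in
/-- **Summing the cell estimates over a uniform partition of `[s, t]` into `N` cells of length `h`.**
[folklore] -/
theorem abs_setIntegral_sub_le_of_partitionK {s t : ℝ≥0} (hst : s ≤ t) {S : Set (ℝ≥0 → ℝ)}
    (hS : MeasurableSet[brownianFiltration s] S) {κ₀ : ℝ} (hκ₀ : 0 < κ₀) {N : ℕ} {h : ℝ≥0}
    (hhN : (N : ℝ≥0) * h = t - s) (hh0 : 0 < h)
    (hh1 : (h : ℝ) ≤ (locLevel n / 2 * (locLevel n / 16) / 4000) ^ 2 / 32)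
    (hh2 : stepSize κ₀ h ≤ locLevel n * (locLevel n / 16) / 1000)
    (hh4 : (h : ℝ) ≤ (κ₀ / stepSigma / 2) ^ 2 / 2)
    (hh5 : lam * (h * massBdCell n) ≤ 1) :
    |∫ ω in S, (locMartK κ α lam hA hne n t ω - locMartK κ α lam hA hne n s ω) ∂preWienerMeasure| ≤
      N * (stepCK α lam (locLevel n / 2) (locLevel n / 16) * h * Real.sqrt h) +
        (powErr α (2 * cellErr n κ₀ h) + lam * (h * massBdCell n)) +
        N * (128 * (h : ℝ) ^ 2 / (κ₀ / stepSigma) ^ 4) := by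
  haveI := isProbabilityMeasure_preWienerMeasure'
  obtain ⟨hαpos, hlam0⟩ := exponents_pos hκ hαdef hlamdef hκ0
  have hSm : MeasurableSet S := brownianFiltration.le s _ hS
  set T := locTimeK κ hA hne n with hT
  set u : ℕ → ℝ≥0 := fun i ↦ s + (i : ℝ≥0) * h with hu
  have hu0 : u 0 = s := by simp [hu]
  have huN : u N = t := by
    rw [hu]; simp only; rw [hhN, add_tsub_cancel_of_le hst]
  have husucc : ∀ i, u (i + 1) = u i + h := fun i ↦ by simp only [hu]; push_cast; ring
  have hsu : ∀ i, s ≤ u i := fun i ↦ by simp only [hu]; exact le_self_add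
  -- telescoping
  have hint : ∀ i, Integrable (locMartK κ α lam hA hne n (u i)) preWienerMeasure := fun i ↦ integrable_locMartK hαpos hlam0 _
  have htel : ∫ ω in S, (locMartK κ α lam hA hne n t ω - locMartK κ α lam hA hne n s ω) ∂preWienerMeasure =
      ∑ i ∈ Finset.range N, ∫ ω in S, (locMartK κ α lam hA hne n (u (i + 1)) ω - locMartK κ α lam hA hne n (u i) ω) ∂preWienerMeasure := by
    have e1 : (fun ω ↦ locMartK κ α lam hA hne n t ω - locMartK κ α lam hA hne n s ω) =
        fun ω ↦ ∑ i ∈ Finset.range N, (locMartK κ α lam hA hne n (u (i + 1)) ω - locMartK κ α lam hA hne n (u i) ω) := by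
      funext ω
      rw [Finset.sum_range_sub (fun i ↦ locMartK κ α lam hA hne n (u i) ω), huN, hu0]
    have hint' : ∀ i ∈ Finset.range N, Integrable (fun ω ↦ locMartK κ α lam hA hne n (u (i + 1)) ω - locMartK κ α lam hA hne n (u i) ω)
        (preWienerMeasure.restrict S) := fun i _ ↦ ((hint (i + 1)).sub (hint i)).integrableOn
    rw [e1]
    exact integral_finsetSum (Finset.range N)
      (f := fun i ω ↦ locMartK κ α lam hA hne n (u (i + 1)) ω - locMartK κ α lam hA hne n (u i) ω) hint'
  rw [htel]
  -- the events `{u_i < T < u_{i+1}}` are pairwise disjoint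
  set E : ℕ → Set (ℝ≥0 → ℝ) := fun i ↦ {ω | ((u i : ℝ≥0) : WithTop ℝ≥0) < T ω ∧ T ω < ((u i + h : ℝ≥0) : WithTop ℝ≥0)} with hE
  have hEm : ∀ i, MeasurableSet (E i) := fun i ↦ by
    obtain ⟨-, -, -, h1, h2, -⟩ := measurable_piecesK (κ := κ) (lam := lam) (hA := hA) (hne := hne) (n := n) hαpos (u i) h
    exact h1.inter h2
  have hdisj : Set.PairwiseDisjoint (↑(Finset.range N) : Set ℕ) E := by
    intro i _ j _ hij
    rw [Function.onFun, Set.disjoint_left]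
    rintro ω ⟨hi1, hi2⟩ ⟨hj1, hj2⟩
    have hh0' : (0 : ℝ) < h := hh0
    have hji : u j < u i + h := by
      have := hj1.trans hi2; exact_mod_cast this
    have hij' : u i < u j + h := by
      have := hi1.trans hj2; exact_mod_cast this
    have hji_r : (s : ℝ) + j * h < s + i * h + h := by
      have := hji; simp only [hu] at this; exact_mod_cast this
    have hij_r : (s : ℝ) + i * h < s + j * h + h := by
      have := hij'; simp only [hu] at this; exact_mod_cast this
    rcases lt_or_gt_of_ne hij with hlt | hlt
    · have : (i : ℝ) + 1 ≤ j := by exact_mod_cast hlt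
      nlinarith
    · have : (j : ℝ) + 1 ≤ i := by exact_mod_cast hlt
      nlinarith
  have hsumE : ∑ i ∈ Finset.range N, preWienerMeasure.real (E i) ≤ 1 := by
    have := sum_measureReal_le_measureReal_univ (μ := preWienerMeasure) (s := Finset.range N) (fun i _ ↦ hEm i) hdisj
    rwa [probReal_univ] at this
  -- sum the cell estimates
  set D : ℝ := powErr α (2 * cellErr n κ₀ h) + lam * (h * massBdCell n) with hD
  have hcell : ∀ i ∈ Finset.range N,
      |∫ ω in S, (locMartK κ α lam hA hne n (u (i + 1)) ω - locMartK κ α lam hA hne n (u i) ω) ∂preWienerMeasure| ≤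
      stepCK α lam (locLevel n / 2) (locLevel n / 16) * h * Real.sqrt h + D * preWienerMeasure.real (E i) +
        128 * (h : ℝ) ^ 2 / (κ₀ / stepSigma) ^ 4 := fun i _ ↦ by
    rw [husucc]
    exact abs_setIntegral_cell_leK hκ0 hκ hαdef hlamdef (hsu i) hS hκ₀ hh0 hh1 hh2 hh4 hh5
  have hD0 : 0 ≤ D := by
    have : 0 ≤ cellErr n κ₀ h := by
      rw [cellErr]; have : 0 ≤ stepSize κ₀ h := by rw [stepSize]; positivity
      have := (locLevel_pos_le n).1; positivity
    exact add_nonneg (powErr_nonneg (by positivity)) (mul_nonneg hlam0 (mul_nonneg h.coe_nonneg (massBdCell_nonneg n)))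
  calc |∑ i ∈ Finset.range N, ∫ ω in S, (locMartK κ α lam hA hne n (u (i + 1)) ω - locMartK κ α lam hA hne n (u i) ω) ∂preWienerMeasure|
      ≤ ∑ i ∈ Finset.range N, |∫ ω in S, (locMartK κ α lam hA hne n (u (i + 1)) ω - locMartK κ α lam hA hne n (u i) ω) ∂preWienerMeasure| :=
        Finset.abs_sum_le_sum_abs _ _
    _ ≤ ∑ i ∈ Finset.range N, (stepCK α lam (locLevel n / 2) (locLevel n / 16) * h * Real.sqrt h +
          D * preWienerMeasure.real (E i) + 128 * (h : ℝ) ^ 2 / (κ₀ / stepSigma) ^ 4) :=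
        Finset.sum_le_sum hcell
    _ = N * (stepCK α lam (locLevel n / 2) (locLevel n / 16) * h * Real.sqrt h) +
          D * ∑ i ∈ Finset.range N, preWienerMeasure.real (E i) +
          N * (128 * (h : ℝ) ^ 2 / (κ₀ / stepSigma) ^ 4) := by
        rw [Finset.sum_add_distrib, Finset.sum_add_distrib, Finset.sum_const, Finset.sum_const, Finset.card_range,
          ← Finset.mul_sum]
        simp [nsmul_eq_mul]
    _ ≤ _ := by
        have := mul_le_mul_of_nonneg_left hsumE hD0
        linarith

/-! ### The increments of `Mⁿ` integrate to zero over `𝓕_s`-events -/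

include hκ0 hκ hαdef hlamdef in
/-- **`∫_S (Mⁿ_t − Mⁿ_s) = 0` for `s ≤ t` and `S ∈ 𝓕_s`**: let the mesh of the partition go to `0`
(the sum of the cell bounds tends to `powErr α (4κ₀/ρ₀)`), then the oscillation threshold `κ₀ → 0`.
[cite: LawlerSchrammWerner2003Restriction, Prop. 5.3] -/
theorem setIntegral_locMartK_sub_eq_zero {s t : ℝ≥0} (hst : s ≤ t) {S : Set (ℝ≥0 → ℝ)}
    (hS : MeasurableSet[brownianFiltration s] S) :
    ∫ ω in S, (locMartK κ α lam hA hne n t ω - locMartK κ α lam hA hne n s ω) ∂preWienerMeasure = 0 := by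
  rcases hst.eq_or_lt with heq | hst'
  · subst heq; simp
  obtain ⟨hαpos, hlam0⟩ := exponents_pos hκ hαdef hlamdef hκ0
  obtain ⟨hc0, hc1⟩ := locLevel_pos_le n
  have hσ := stepSigma_pos
  set c := locLevel n with hc
  set ρ₀ : ℝ := c / 16 with hρ
  have hρ₀ : 0 < ρ₀ := by positivity
  have hMb := massBdCell_nonneg n
  set I : ℝ := ∫ ω in S, (locMartK κ α lam hA hne n t ω - locMartK κ α lam hA hne n s ω) ∂preWienerMeasure with hI
  have hts : (0 : ℝ) < (t : ℝ) - s := by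
    have : (s : ℝ) < t := by exact_mod_cast hst'
    linarith
  -- the mesh `h_N = (t - s)/(N + 1)` and its limits
  set hN : ℕ → ℝ≥0 := fun N ↦ (t - s) / ((N : ℝ≥0) + 1) with hhN
  have hhN' : ∀ N : ℕ, (((N + 1 : ℕ) : ℝ≥0)) * hN N = t - s := fun N ↦ by
    simp only [hhN]; push_cast
    rw [mul_div_cancel₀ _ (by positivity)]
  have hcoe : ∀ N : ℕ, (hN N : ℝ) = ((t : ℝ) - s) / ((N : ℝ) + 1) := fun N ↦ by
    simp only [hhN]; push_cast [NNReal.coe_sub hst]; ring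
  have hh_pos : ∀ N, 0 < hN N := fun N ↦ by
    have : (0 : ℝ) < hN N := by rw [hcoe]; positivity
    exact_mod_cast this
  have hh_tend : Tendsto (fun N ↦ (hN N : ℝ)) atTop (𝓝 0) := by
    simp_rw [hcoe]
    exact tendsto_const_nhds.div_atTop (tendsto_natCast_atTop_atTop.atTop_add tendsto_const_nhds)
  have hsqrt_tend : Tendsto (fun N ↦ Real.sqrt (hN N)) atTop (𝓝 0) := by
    have := (Real.continuous_sqrt.tendsto 0).comp hh_tend
    rwa [Function.comp_def, Real.sqrt_zero] at this
  have hNh : ∀ N : ℕ, ((N + 1 : ℕ) : ℝ) * (hN N : ℝ) = (t : ℝ) - s := fun N ↦ by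
    rw [hcoe]; push_cast; field_simp
  set Cst : ℝ := stepCK α lam (c / 2) ρ₀ with hCst
  -- Step 1: for every small `κ₀ > 0`, `|I| ≤ powErr α (4κ₀/ρ₀)`
  have step1 : ∀ κ₀ : ℝ, 0 < κ₀ → κ₀ ≤ c * ρ₀ / 2000 → |I| ≤ powErr α (2 * (2 * κ₀ / ρ₀)) := by
    intro κ₀ hκ₀ hκc
    set RHS : ℕ → ℝ := fun N ↦ ((N + 1 : ℕ) : ℝ) * (Cst * hN N * Real.sqrt (hN N)) +
        (powErr α (2 * cellErr n κ₀ (hN N)) + lam * (hN N * massBdCell n)) +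
        ((N + 1 : ℕ) : ℝ) * (128 * (hN N : ℝ) ^ 2 / (κ₀ / stepSigma) ^ 4) with hRHS
    have hRHS_eq : ∀ N, RHS N = Cst * ((t : ℝ) - s) * Real.sqrt (hN N) +
        (powErr α (2 * cellErr n κ₀ (hN N)) + lam * (hN N * massBdCell n)) +
        128 * ((t : ℝ) - s) * (hN N : ℝ) / (κ₀ / stepSigma) ^ 4 := fun N ↦ by
      simp only [hRHS]
      have e := hNh N
      have e1 : ((N + 1 : ℕ) : ℝ) * (Cst * hN N * Real.sqrt (hN N)) = Cst * (((N + 1 : ℕ) : ℝ) * hN N) * Real.sqrt (hN N) := by ring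
      have e2 : ((N + 1 : ℕ) : ℝ) * (128 * (hN N : ℝ) ^ 2 / (κ₀ / stepSigma) ^ 4) =
          128 * (((N + 1 : ℕ) : ℝ) * hN N) * hN N / (κ₀ / stepSigma) ^ 4 := by ring
      rw [e1, e2, e]
    have hce : Tendsto (fun N ↦ cellErr n κ₀ (hN N)) atTop (𝓝 (50 * 0 / ρ₀ ^ 2 + 2 * (κ₀ + 4 * 0) / ρ₀)) := by
      have : (fun N ↦ cellErr n κ₀ (hN N)) = fun N ↦ 50 * (hN N : ℝ) / ρ₀ ^ 2 + 2 * (κ₀ + 4 * Real.sqrt (hN N)) / ρ₀ := by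
        funext N; rw [cellErr, stepSize]
      rw [this]
      exact ((tendsto_const_nhds.mul hh_tend).div_const _).add
        ((tendsto_const_nhds.mul (tendsto_const_nhds.add (tendsto_const_nhds.mul hsqrt_tend))).div_const _)
    have hlim : Tendsto RHS atTop (𝓝 (powErr α (2 * (2 * κ₀ / ρ₀)))) := by
      have h1 : Tendsto (fun N ↦ Cst * ((t : ℝ) - s) * Real.sqrt (hN N)) atTop (𝓝 0) := by
        have := tendsto_const_nhds (x := Cst * ((t : ℝ) - s)) |>.mul hsqrt_tend
        rwa [mul_zero] at this
      have h2 : Tendsto (fun N ↦ powErr α (2 * cellErr n κ₀ (hN N)) + lam * (hN N * massBdCell n)) atTop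
          (𝓝 (powErr α (2 * (2 * κ₀ / ρ₀)) + 0)) := by
        have ha : Tendsto (fun N ↦ powErr α (2 * cellErr n κ₀ (hN N))) atTop (𝓝 (powErr α (2 * (2 * κ₀ / ρ₀)))) := by
          have := tendsto_powErr hαpos ((tendsto_const_nhds (x := (2 : ℝ))).mul hce)
          convert this using 3; ring
        have hb : Tendsto (fun N ↦ lam * (hN N * massBdCell n)) atTop (𝓝 0) := by
          have := (tendsto_const_nhds (x := lam)).mul (hh_tend.mul (tendsto_const_nhds (x := massBdCell n)))
          rwa [zero_mul, mul_zero] at this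
        exact ha.add hb
      have h3 : Tendsto (fun N ↦ 128 * ((t : ℝ) - s) * (hN N : ℝ) / (κ₀ / stepSigma) ^ 4) atTop (𝓝 0) := by
        have := ((tendsto_const_nhds (x := 128 * ((t : ℝ) - s))).mul hh_tend).div_const ((κ₀ / stepSigma) ^ 4)
        rwa [mul_zero, zero_div] at this
      have := (h1.add h2).add h3
      rw [zero_add, add_zero, add_zero] at this
      exact this.congr fun N ↦ (hRHS_eq N).symm
    -- eventually all smallness conditions hold, and then `|I| ≤ RHS N`
    have hK1 : (0 : ℝ) < (c / 2 * ρ₀ / 4000) ^ 2 / 32 := by positivity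
    have hK4 : (0 : ℝ) < (κ₀ / stepSigma / 2) ^ 2 / 2 := by positivity
    have hK2 : (0 : ℝ) < c * ρ₀ / 8000 := by positivity
    have h5t : Tendsto (fun N ↦ lam * (hN N * massBdCell n)) atTop (𝓝 0) := by
      have := (tendsto_const_nhds (x := lam)).mul (hh_tend.mul (tendsto_const_nhds (x := massBdCell n)))
      rwa [zero_mul, mul_zero] at this
    have hev : ∀ᶠ N in atTop, |I| ≤ RHS N := by
      filter_upwards [hh_tend.eventually (eventually_le_nhds hK1), hh_tend.eventually (eventually_le_nhds hK4),
        hsqrt_tend.eventually (eventually_le_nhds hK2), h5t.eventually (eventually_le_nhds one_pos)] with N h1 h4 h2 h5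
      have hh2 : stepSize κ₀ (hN N) ≤ c * ρ₀ / 1000 := by rw [stepSize]; linarith
      exact abs_setIntegral_sub_le_of_partitionK (κ := κ) (hA := hA) (hne := hne) (n := n) hκ0 hκ hαdef hlamdef hst hS hκ₀
        (N := N + 1) (hhN' N) (hh_pos N) h1 hh2 h4 h5
    exact ge_of_tendsto hlim hev
  -- Step 2: `κ₀ → 0`
  have hL : Tendsto (fun κ₀ : ℝ ↦ powErr α (2 * (2 * κ₀ / ρ₀))) (𝓝[>] 0) (𝓝 0) := by
    have h1 : Tendsto (fun κ₀ : ℝ ↦ 2 * (2 * κ₀ / ρ₀)) (𝓝 0) (𝓝 (2 * (2 * 0 / ρ₀))) :=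
      ((continuous_const.mul ((continuous_const.mul continuous_id).div_const _)).tendsto 0)
    have h2 := tendsto_powErr hαpos h1
    rw [show 2 * (2 * (0 : ℝ) / ρ₀) = 0 by ring, powErr_zero hαpos] at h2
    exact h2.mono_left nhdsWithin_le_nhds
  have hevκ : ∀ᶠ κ₀ in 𝓝[>] (0 : ℝ), |I| ≤ powErr α (2 * (2 * κ₀ / ρ₀)) := by
    have hpos : ∀ᶠ κ₀ in 𝓝[>] (0 : ℝ), 0 < κ₀ := eventually_mem_nhdsWithin
    have hsmall : ∀ᶠ κ₀ in 𝓝[>] (0 : ℝ), κ₀ ≤ c * ρ₀ / 2000 :=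
      (eventually_le_nhds (by positivity : (0 : ℝ) < c * ρ₀ / 2000)).filter_mono nhdsWithin_le_nhds
    filter_upwards [hpos, hsmall] with κ₀ h1 h2
    exact step1 κ₀ h1 h2
  have hI0 : |I| ≤ 0 := ge_of_tendsto hL hevκ
  exact abs_nonpos_iff.1 hI0

end Partition

/-! ### The martingale -/

include hκ0 hκ hαdef hlamdef in
/-- **[LSW] Prop. 5.3 (`0 < κ ≤ 8/3`), localised**: for every nonempty `*`-hull `A` and `n`, the stopped
process `Mⁿ_t = Φ′_{A_{t∧Tₙ} − W_{t∧Tₙ}}(0)^α exp(−λ ∫₀^{t∧Tₙ} m(A_s − W_s) ds)` (`locMartK`) is a bounded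
`𝓕`-martingale of the SLE_κ driving Brownian motion. [cite: LawlerSchrammWerner2003Restriction, Prop. 5.3] -/
theorem martingale_locMartK : Martingale (locMartK κ α lam hA hne n) brownianFiltration preWienerMeasure := by
  letI : MeasurableSpace C(ℝ≥0, ℝ) := borel _
  haveI : BorelSpace C(ℝ≥0, ℝ) := ⟨rfl⟩
  haveI := isProbabilityMeasure_preWienerMeasure'
  obtain ⟨hαpos, hlam0⟩ := exponents_pos hκ hαdef hlamdef hκ0
  refine ⟨stronglyAdapted_locMartK hαpos, fun i j hij ↦ ?_⟩
  have hm : brownianFiltration i ≤ (inferInstance : MeasurableSpace (ℝ≥0 → ℝ)) := brownianFiltration.le i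
  haveI : IsFiniteMeasure (preWienerMeasure.trim hm) := isFiniteMeasure_trim hm
  refine (ae_eq_condExp_of_forall_setIntegral_eq hm (integrable_locMartK hαpos hlam0 j)
    (fun S _ _ ↦ (integrable_locMartK hαpos hlam0 i).integrableOn) (fun S hS _ ↦ ?_)
    (((stronglyAdapted_locMartK hαpos) i).aestronglyMeasurable)).symm
  have h0 := setIntegral_locMartK_sub_eq_zero (κ := κ) (hA := hA) (hne := hne) (n := n) hκ0 hκ hαdef hlamdef hij hS
  rw [integral_sub (integrable_locMartK hαpos hlam0 j).integrableOn (integrable_locMartK hαpos hlam0 i).integrableOn,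
    sub_eq_zero] at h0
  exact h0.symm

/-- `0 ≤ Mⁿ ≤ 1`, from the exponents. [folklore] -/
theorem locMartK_mem_Icc' (hκ0 : 0 < κ) (hκ : κ ≤ 8 / 3) (hαdef : α = (6 - κ) / (2 * κ))
    (hlamdef : lam = (8 - 3 * κ) * (6 - κ) / (2 * κ)) (t : ℝ≥0) (ω : ℝ≥0 → ℝ) :
    locMartK κ α lam hA hne n t ω ∈ Icc (0 : ℝ) 1 := by
  obtain ⟨hαpos, hlam0⟩ := exponents_pos hκ hαdef hlamdef hκ0
  exact locMartK_mem_Icc hαpos hlam0 t ω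

end LocMart

end Literature.Probability.RandomPlanarGeometry

end
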